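import Literature.Barriers.PneNP.TSPExtensionComplexityMatchingsOps
import Mathlib.Data.Real.Basic
import Mathlib.Algebra.BigOperators.Ring.Finset
import Mathlib.Data.Fintype.BigOperators
import HarnessLib

/-!
# Transport of the odd-cut weight matrix along a bijection of the vertex type

Support file for the discharge of `Literature.Barriers.PneNP.Rothvoss2017_tsp`. The
combinatorial core (Rothvoß 2017, Lemma 6) is proved on a structured vertex type (`Slot m q`),
while the perfect matching polytope `P_PM(n)` lives on `Fin n`; the datum passed between them is
purely combinatorial — a weight matrix `W` on (`t`-vertex-sets) × (perfect matchings) with a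
bound on all rectangle sums and the normalisation `Σ W_{UM} (|δ(U) ∩ M| - 1) = 1` — and this
file moves such a datum along any bijection `e : V ≃ V'` (`exists_weights_transport`): cuts map
by `Finset.map`, matchings by `Sym2.map`, and `|δ(U) ∩ M|` is invariant (`card_cut_image`).
All [folklore].
-/

noncomputable section

namespace Literature.Barriers.PneNP

open Finset

variable {V V' : Type*} [DecidableEq V] [DecidableEq V']

/-- `cutCount` is invariant under injective relabelling. [folklore] -/
theorem cutCount_map (e : V ↪ V') (U : Finset V) (f : Sym2 V) :
    cutCount (U.map e) (Sym2.map e f) = cutCount U f := by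
  induction f using Sym2.ind with
  | h a b =>
    rw [Sym2.map_mk, cutCount_mk, cutCount_mk]
    simp

/-- The number of edges of `M` cut by `U` is invariant under injective relabelling. [folklore] -/
theorem card_cut_image (e : V ↪ V') (U : Finset V) (M : Finset (Sym2 V)) :
    ((M.image (Sym2.map e)).filter fun f => cutCount (U.map e) f = 1).card =
      (M.filter fun f => cutCount U f = 1).card := by
  rw [← card_image_of_injective (M.filter fun f => cutCount U f = 1)
    (Sym2.map.injective e.injective)]
  congr 1
  ext f
  simp only [mem_filter, mem_image]
  constructor
  · rintro ⟨⟨g, hg, rfl⟩, hcut⟩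
    rw [cutCount_map] at hcut
    exact ⟨g, ⟨hg, hcut⟩, rfl⟩
  · rintro ⟨g, ⟨hg, hcut⟩, rfl⟩
    exact ⟨⟨g, hg, rfl⟩, by rw [cutCount_map]; exact hcut⟩

section

variable [Fintype V] [Fintype V'] (e : V ≃ V') (t : ℕ)

/-- `t`-sets correspond along `e`. [folklore] -/
def cutEquiv : {U : Finset V // U.card = t} ≃ {U : Finset V' // U.card = t} where
  toFun a := ⟨a.1.map e.toEmbedding, by rw [card_map]; exact a.2⟩
  invFun a := ⟨a.1.map e.symm.toEmbedding, by rw [card_map]; exact a.2⟩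
  left_inv a := by
    apply Subtype.ext
    simp only [map_map]
    conv_rhs => rw [← map_refl (s := a.1)]
    congr 1
    ext x
    simp
  right_inv a := by
    apply Subtype.ext
    simp only [map_map]
    conv_rhs => rw [← map_refl (s := a.1)]
    congr 1
    ext x
    simp

/-- Perfect matchings of the whole vertex type correspond along `e`. [folklore] -/
def pmEquiv : {M : Finset (Sym2 V) // IsPMOn univ M} ≃ {M : Finset (Sym2 V') // IsPMOn univ M} where
  toFun b := ⟨b.1.image (Sym2.map e), by
    have := b.2.image e (e.injective.injOn)
    rwa [image_univ_equiv] at this⟩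
  invFun b := ⟨b.1.image (Sym2.map e.symm), by
    have := b.2.image e.symm (e.symm.injective.injOn)
    rwa [image_univ_equiv] at this⟩
  left_inv b := by
    apply Subtype.ext
    simp only [image_image]
    conv_rhs => rw [← image_id (s := b.1)]
    refine image_congr fun f _ => ?_
    show Sym2.map e.symm (Sym2.map e f) = id f
    rw [Sym2.map_map, Equiv.symm_comp_self, Sym2.map_id]
  right_inv b := by
    apply Subtype.ext
    simp only [image_image]
    conv_rhs => rw [← image_id (s := b.1)]
    refine image_congr fun f _ => ?_
    show Sym2.map e (Sym2.map e.symm f) = id f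
    rw [Sym2.map_map, Equiv.self_comp_symm, Sym2.map_id]

/-- The cut count is preserved by the correspondences. [folklore] -/
theorem card_cut_equiv (a : {U : Finset V // U.card = t}) (b : {M : Finset (Sym2 V) // IsPMOn univ M}) :
    (((pmEquiv e b : {M : Finset (Sym2 V') // IsPMOn univ M}) : Finset (Sym2 V')).filter
        fun f => cutCount ((cutEquiv e t a : {U : Finset V' // U.card = t}) : Finset V') f = 1).card =
      ((b : Finset (Sym2 V)).filter fun f => cutCount (a : Finset V) f = 1).card := by
  exact card_cut_image e.toEmbedding a.1 b.1

end

/-- **Transport of Rothvoß's weight datum along a bijection of the vertex type.**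
[folklore] -/
theorem exists_weights_transport [Fintype V] [Fintype V'] (e : V ≃ V') (t : ℕ) (α s : ℝ)
    (h : ∃ W : {U : Finset V // U.card = t} → {M : Finset (Sym2 V) // IsPMOn univ M} → ℝ,
      (∀ (X : Finset {U : Finset V // U.card = t}) (Y : Finset {M : Finset (Sym2 V) // IsPMOn univ M}),
          ∑ a ∈ X, ∑ b ∈ Y, W a b ≤ α) ∧
        ∑ a, ∑ b, W a b * ((((b : Finset (Sym2 V)).filter
          fun f => cutCount (a : Finset V) f = 1).card : ℝ) - 1) = s) :
    ∃ W : {U : Finset V' // U.card = t} → {M : Finset (Sym2 V') // IsPMOn univ M} → ℝ,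
      (∀ (X : Finset {U : Finset V' // U.card = t}) (Y : Finset {M : Finset (Sym2 V') // IsPMOn univ M}),
          ∑ a ∈ X, ∑ b ∈ Y, W a b ≤ α) ∧
        ∑ a, ∑ b, W a b * ((((b : Finset (Sym2 V')).filter
          fun f => cutCount (a : Finset V') f = 1).card : ℝ) - 1) = s := by
  obtain ⟨W, hrect, hsum⟩ := h
  set eU := cutEquiv e t with heU
  set eM := pmEquiv e with heM
  refine ⟨fun a b => W (eU.symm a) (eM.symm b), fun X Y => ?_, ?_⟩
  · have := hrect (X.map eU.symm.toEmbedding) (Y.map eM.symm.toEmbedding)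
    simpa [sum_map] using this
  · rw [← hsum, ← Equiv.sum_comp eU]
    refine sum_congr rfl fun a _ => ?_
    rw [← Equiv.sum_comp eM]
    refine sum_congr rfl fun b _ => ?_
    dsimp only
    rw [Equiv.symm_apply_apply, Equiv.symm_apply_apply, heU, heM, card_cut_equiv]

end Literature.Barriers.PneNP

end
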